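/-
Copyright (c) 2026 the pub-hodgecm-mathlib formalisation cell (harness21).  Prover seat hodgecm-mathlib-LH7-p04 (g11), 2026-09-02∕03.
Road M6 → F3 «TOT-Λ BY OVER-ORDERS» (dealer LH4-plan (g8) WORD #74∕#75∕#76∕#77 by name), brick F3-2b, FILE 2 «PARTITION BY MULTIPLIER ORDERS».
-/
import Literature.NumberTheory.Automorphic.SelfDualCyclicOverOrderTorsor   -- ★ F3-2a (LH10-p01 (g10)) p852941: `Λ_O(w)`, membership, translation, multiplier reading at `w₀`, the count `#S_O`
import Literature.NumberTheory.Automorphic.SelfDualLatticeTransport        -- ★ F3-2b FILE 1 (this seat): (T1) orbit map, (T2) self-duality in membership form, (T3) three-to-two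
import Literature.NumberTheory.Automorphic.QuadraticLatticePrincipal       -- ★ (O4-G) FILE 2 (this seat) p852849: `exists_generator_of_selfDual_glued`
import HarnessLib

/-!
# Self-dual lattices are partitioned by their multiplier over-orders: every self-dual lattice is cyclic over its multiplier ring

Topic `NumberTheory/Automorphic`; namespace `Literature.NumberTheory.Automorphic`.  THEOREMS ONLY (no definition, no instance, no notation, no named fact, no `sorry`).
Cell `pub/hodgecm-mathlib` (D-0151), crux H413 = `stmt-HodgeConjecture-24833`; road M6 → F3 «TOT-Λ by over-orders», brick **F3-2b FILE 2** (WORD #75 (B): (A8-lite), (B1), (B2)).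
HONEST LABEL: HC_CM is proved only modulo the 2 remaining named inputs (hLiu418 24832, h413 24833) until rung 0 closes; elementary lattice algebra over a valuation ring,
asserts nothing printed; count-neutral base-layer brick ((O4) is not an organ).  NO `2`, NO `d`, NO discreteness, NO residue-field finiteness.

FRAME = ★ F3-2a `SelfDualCyclicOverOrderTorsor` VERBATIM (`E` with a `ValuativeRel`, involution `σ` with `σ(𝒪) ⊆ 𝒪`, `J ∈ GL_n(𝒪)`, a regular `τ` with cyclic vector `w₀`, a commutative
carrier `φ : B → M_n(E)` (injective, `φ τ_B = τ`), an over-order `O ≤ B` containing the scalars; `Λ(g) = span_𝒪 (cols g)`, `Λ_O(w) = span_𝒪 {φ(b)·w : b ∈ O}`), and for §1–§2 the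
ENDOSCOPIC CARRIER `B := E × K` (`K` a field, `[K : E] = 2`, `n = 3`), adjoint `b ↦ b⋆ := (σ b₁, σ_K b₂)` (`hstar : J·φ(b⋆) = σ(φ b)ᵀ·J`), and the binder
`hordσ : every multiplier-stable f.g. 𝒪-submodule of K is σ_K-multiplier-stable` (ALLOWED, WORD #77; discharged in the concrete frame by F3-3∕F3-5: the orders of `K ⊇ 𝒪_E` are `σ_K`-stable).

THE MATHEMATICS.  §0 (any `B`): `Λ(g)` spans `Eⁿ`; the orbit map `Ψ : b ↦ φ(b)·w₀` is an `E`-linear isomorphism `B ≅ Eⁿ` (★ (T1)); a carrier element acting surjectively is a unit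
(Cayley–Hamilton, ★ `nonsing_inv_mem_adjoin`); `O` stabilises every `Λ_O(w)`; **(A8) multiplier reading for FULL `O`-cyclic lattices**: if `Λ_O(w) = Λ(g)` for some `g ∈ GL_n` then
`{x : φ(x)·Λ_O(w) ≤ Λ_O(w)} = O` (`w = φ(a) w₀` with `a ∈ B^×`, then ★ F3-2a `setOf_map_le_span_image_eq`) — distinct over-orders have DISJOINT strata.
§1 **(B1) COMPLETENESS** (`B = E × K`): every self-dual lattice `Λ = Λ(u)`, `u ∈ U(σ,J)`, is `O(Λ)`-cyclic for its multiplier ring `O(Λ) := {x : φ(x)·Λ ≤ Λ}` (a subring containing `𝒪`):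
pull `Λ` back along `Ψ` to `Λ′ ≤ E × K`; the pairing `P(m, m′) := σ(Ψ m)ᵀ J (Ψ m′)` satisfies `P(bm, m′) = P(m, b⋆m′)`, hence is ORTHOGONAL for `E × 0 ⊥ 0 × K` (`e₁⋆ = e₁`,
`e₁e₂ = 0`) with `K`-part `T(x, c x′) = T(σ_K(c) x, x′)`; self-duality in membership form (★ (T2)) is `m′ ∈ Λ′ ⟺ P(Λ′, m′) ⊆ 𝒪`; `pr_K Λ′` is spanned by the `K`-parts of the three
columns, reduced to an `E`-independent pair `a, b` with `(b∕a)² = s(b∕a) − m` (★ (T3)); so ★ (O4-G) `exists_generator_of_selfDual_glued` applies: `Λ′ = O(Λ′)·v`, and pushing forward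
`Λ = Λ_{O(Λ)}(Ψ v)`.  §2 **(B2) PARTITION**: with `R`-stability (`τ·Λ ≤ Λ ⟺ τ_B ∈ O(Λ)`), the self-dual `τ`-stable lattices are the DISJOINT union of the strata
`S_O = {Λ | self-dual ∧ ∃ w, Λ = Λ_O(w)}` over the over-orders `O ∋ τ_B` that occur, and `#{self-dual τ-stable Λ} = Σ_{O ∈ 𝓞} #S_O` for any finite list `𝓞` of over-orders
`∋ τ_B` containing every multiplier ring (each `#S_O = [C_O : O^×]` by ★ F3-2a).  Left to F3-3∕F3-5: the list `𝓞` (glued orders `G(N″,b,c′)`, ★ F3-1a) and (B3) monogenic support.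

* §0 `span_range_transpose_eq_top`, `exists_linearEquiv_eq_mulVec`, `isUnit_of_surjective_mulVec`, `map_span_image_le_of_mem`, **`setOf_map_le_span_image_eq_of_eq_span_range`** (A8),
  `eq_of_span_image_eq_span_image`.
* §1 **`exists_subring_span_image_eq_of_selfDual`** (B1).
* §2 **`setOf_selfDual_stable_eq_biUnion`**, **`ncard_setOf_selfDual_stable_eq_finsum`** (B2).

## References
* [Jacobowitz1962] R. Jacobowitz, *Hermitian forms over local fields*, Amer. J. Math. 84 (1962): §4, §7 (dual and unimodular lattices; lattices of a type as a units-torsor).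
* [Bass1963] H. Bass, *On the ubiquity of Gorenstein rings*, Math. Z. 82 (1963): §7 (lattices over orders are cyclic over their multiplier rings in the quadratic case).
* [Serre1980Trees] J.-P. Serre, *Trees* (1980): Ch. II §1.1 (lattices over valuation rings).
* [Rogawski1990] J. D. Rogawski, *Automorphic Representations of Unitary Groups in Three Variables* (1990): §4.9 Lemma 4.9.3 p. 56 (orbital integrals as lattice counts).
-/

set_option autoImplicit false

noncomputable section

open Matrix
open scoped MatrixGroups ValuativeRel Pointwise

namespace Literature.NumberTheory.Automorphic

open Literature.NumberTheory.Automorphic.UnitaryGroup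

/-! ## §0 Fullness, the orbit isomorphism, units, `O`-stability, and the multiplier reading for full `O`-cyclic lattices -/

section General

variable {E : Type*} [Field E] [ValuativeRel E] {n : ℕ} {B : Type*} [CommRing B] [Algebra E B]
  (τ : Matrix (Fin n) (Fin n) E) {w₀ : Fin n → E} (hK : IsUnit (Matrix.of fun i j : Fin n => ((τ ^ (j : ℕ)) *ᵥ w₀) i).det)
  (φ : B →ₐ[E] Matrix (Fin n) (Fin n) E) (hφ : Function.Injective φ) (τB : B) (hτB : φ τB = τ)
  (O : Subring B) (hO : ∀ r : 𝒪[E], algebraMap E B (r : E) ∈ O)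

omit [ValuativeRel E] in
/-- **Fullness**: the columns of an invertible matrix span `Eⁿ` over `E` (`y = Σ_j (g⁻¹y)_j · col_j g`). [cite: Serre1980Trees, Ch. II §1.1] -/
theorem span_range_transpose_eq_top (g : GL (Fin n) E) : Submodule.span E (Set.range ((g : Matrix (Fin n) (Fin n) E))ᵀ) = ⊤ := by
  rw [eq_top_iff]
  intro y _
  have hy : y = ∑ j, (((g⁻¹ : GL (Fin n) E) : Matrix (Fin n) (Fin n) E) *ᵥ y) j • ((g : Matrix (Fin n) (Fin n) E))ᵀ j := by
    have h : (g : Matrix (Fin n) (Fin n) E) *ᵥ ((((g⁻¹ : GL (Fin n) E) : Matrix (Fin n) (Fin n) E)) *ᵥ y) = y := by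
      rw [Matrix.mulVec_mulVec, Units.mul_inv, Matrix.one_mulVec]
    conv_lhs => rw [← h]
    funext i
    simp only [Matrix.mulVec, dotProduct, Finset.sum_apply, Pi.smul_apply, smul_eq_mul, Matrix.transpose_apply, mul_comm]
  rw [hy]
  exact Submodule.sum_mem _ fun j _ => Submodule.smul_mem _ _ (Submodule.subset_span ⟨j, rfl⟩)

include hK hφ hτB in
omit [ValuativeRel E] in
/-- **The orbit isomorphism** `Ψ : B ≅ Eⁿ`, `Ψ b = φ(b)·w₀` (onto and one-to-one by ★ (T1)). [cite: HornJohnson2013, §3.2.4] -/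
theorem exists_linearEquiv_eq_mulVec : ∃ Ψ : B ≃ₗ[E] (Fin n → E), ∀ b, Ψ b = φ b *ᵥ w₀ := by
  let ψ : B →ₗ[E] (Fin n → E) :=
    { toFun := fun b => φ b *ᵥ w₀
      map_add' := fun b b' => by simp only [map_add, Matrix.add_mulVec]
      map_smul' := fun c b => by simp only [map_smul, Matrix.smul_mulVec, RingHom.id_apply] }
  have hinj : Function.Injective ψ := by
    intro b b' h
    have h0 : φ (b - b') *ᵥ w₀ = 0 := by
      change φ b *ᵥ w₀ = φ b' *ᵥ w₀ at h
      rw [map_sub, Matrix.sub_mulVec, h, sub_self]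
    exact sub_eq_zero.1 (eq_zero_of_map_mulVec_eq_zero τ hK φ hφ τB hτB h0)
  have hsurj : Function.Surjective ψ := fun w => exists_map_mulVec_eq τ hK φ τB hτB w
  exact ⟨LinearEquiv.ofBijective ψ ⟨hinj, hsurj⟩, fun b => rfl⟩

include hφ in
omit [ValuativeRel E] in
/-- **A carrier element acting surjectively is a unit of `B`**: `φ(a)` is invertible, its inverse is a polynomial in `φ(a)` (Cayley–Hamilton, ★ `nonsing_inv_mem_adjoin`), hence
`= φ(a′)`, and `a a′ = 1` by injectivity of `φ`. [cite: HornJohnson2013, Thm 2.4.3.2] -/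
theorem isUnit_of_surjective_mulVec (a : B) (h : Function.Surjective (φ a).mulVec) : IsUnit a := by
  have hdet : IsUnit (φ a).det := (Matrix.isUnit_iff_isUnit_det _).1 (Matrix.mulVec_surjective_iff_isUnit.1 h)
  have hmem : (φ a)⁻¹ ∈ (Algebra.adjoin E ({a} : Set B)).map φ := by
    rw [AlgHom.map_adjoin_singleton]
    exact nonsing_inv_mem_adjoin (φ a) hdet
  obtain ⟨a', -, ha'⟩ := Subalgebra.mem_map.1 hmem
  exact IsUnit.of_mul_eq_one a' (hφ (by rw [map_mul, ha', map_one, Matrix.mul_nonsing_inv _ hdet]))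

include hO in
/-- **`O` stabilises `Λ_O(w)`**: `φ(x)·Λ_O(w) ≤ Λ_O(w)` for `x ∈ O`. [cite: Serre1980Trees, Ch. II §1.1] -/
theorem map_span_image_le_of_mem (x : B) (hx : x ∈ O) (w : Fin n → E) :
    (Submodule.span 𝒪[E] ((fun b : B => φ b *ᵥ w) '' (O : Set B))).map ((Matrix.toLin' (φ x)).restrictScalars 𝒪[E]) ≤
      Submodule.span 𝒪[E] ((fun b : B => φ b *ᵥ w) '' (O : Set B)) := by
  rw [← span_image_mulVec_mulVec_eq_map, Submodule.span_le]
  rintro _ ⟨b, hb, rfl⟩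
  exact (mem_span_image_mulVec_iff φ O hO _ _).2 ⟨b * x, O.mul_mem hb hx, by rw [map_mul, ← Matrix.mulVec_mulVec]⟩

include hK hφ hτB hO in
/-- **(A8) THE MULTIPLIER READING FOR A FULL `O`-CYCLIC LATTICE**: if `Λ_O(w) = Λ(g)` for some `g ∈ GL_n(E)` then `{x ∈ B : φ(x)·Λ_O(w) ≤ Λ_O(w)} = O`.  (`w = φ(a)·w₀` with `φ(a)` onto
`span_E Λ(g) = Eⁿ`, so `a ∈ B^×`; translate ★ F3-2a `setOf_map_le_span_image_eq` by `φ(a)`.)  Hence distinct over-orders carry DISJOINT strata.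
[cite: Serre1980Trees, Ch. II §1.1] [cite: Jacobowitz1962, §7] -/
theorem setOf_map_le_span_image_eq_of_eq_span_range (w : Fin n → E) (g : GL (Fin n) E)
    (hg : Submodule.span 𝒪[E] ((fun b : B => φ b *ᵥ w) '' (O : Set B)) = Submodule.span 𝒪[E] (Set.range ((g : Matrix (Fin n) (Fin n) E))ᵀ)) :
    {x : B | (Submodule.span 𝒪[E] ((fun b : B => φ b *ᵥ w) '' (O : Set B))).map ((Matrix.toLin' (φ x)).restrictScalars 𝒪[E]) ≤
      Submodule.span 𝒪[E] ((fun b : B => φ b *ᵥ w) '' (O : Set B))} = (O : Set B) := by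
  obtain ⟨a, rfl⟩ := exists_map_mulVec_eq τ hK φ τB hτB w
  -- `φ(a)` is onto: its range contains the columns of `g`
  have hsurj : Function.Surjective (φ a).mulVec := by
    have hr : LinearMap.range (Matrix.toLin' (φ a)) = ⊤ := by
      rw [eq_top_iff, ← span_range_transpose_eq_top g, Submodule.span_le]
      rintro _ ⟨j, rfl⟩
      have hj : ((g : Matrix (Fin n) (Fin n) E))ᵀ j ∈ Submodule.span 𝒪[E] ((fun b : B => φ b *ᵥ (φ a *ᵥ w₀)) '' (O : Set B)) := by
        rw [hg]; exact Submodule.subset_span ⟨j, rfl⟩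
      obtain ⟨b, -, hb⟩ := (mem_span_image_mulVec_iff φ O hO _ _).1 hj
      refine ⟨φ b *ᵥ w₀, ?_⟩
      rw [Matrix.toLin'_apply, ← hb, Matrix.mulVec_mulVec, Matrix.mulVec_mulVec, ← map_mul, ← map_mul, mul_comm]
    exact LinearMap.range_eq_top.1 hr
  obtain ⟨u, hu⟩ := isUnit_of_surjective_mulVec φ hφ a hsurj
  -- translate by the unit `u`: `Λ_O(φ(u) w₀) = φ(u)·Λ_O(w₀)` and `φ(x)` commutes with `φ(u)`
  have hinj : Function.Injective ((Matrix.toLin' (φ (u : B))).restrictScalars 𝒪[E]) := by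
    intro y y' h
    simp only [LinearMap.coe_restrictScalars, Matrix.toLin'_apply] at h
    have h' := congrArg ((φ ((u⁻¹ : Bˣ) : B)).mulVec) h
    simpa only [Matrix.mulVec_mulVec, ← map_mul, Units.inv_mul, map_one, Matrix.one_mulVec] using h'
  have hcomm : ∀ x : B, ((Matrix.toLin' (φ x)).restrictScalars 𝒪[E]).comp ((Matrix.toLin' (φ (u : B))).restrictScalars 𝒪[E]) =
      ((Matrix.toLin' (φ (u : B))).restrictScalars 𝒪[E]).comp ((Matrix.toLin' (φ x)).restrictScalars 𝒪[E]) := fun x => by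
    apply LinearMap.ext
    intro y
    simp only [LinearMap.coe_comp, Function.comp_apply, LinearMap.coe_restrictScalars, Matrix.toLin'_apply, Matrix.mulVec_mulVec, ← map_mul, mul_comm]
  rw [← hu]
  have hA8 := setOf_map_le_span_image_eq τ hK φ hφ τB hτB O hO
  ext x
  have hx := Set.ext_iff.1 hA8 x
  simp only [Set.mem_setOf_eq] at hx ⊢
  rw [← hx, span_image_mulVec_mulVec_eq_map, ← Submodule.map_comp, hcomm, Submodule.map_comp]
  exact Submodule.map_le_map_iff_of_injective hinj _ _

include hK hφ hτB hO in
/-- **Distinct over-orders carry disjoint strata**: if a full lattice is `O`-cyclic and `O′`-cyclic then `O = O′` (both are its multiplier ring, (A8)). [cite: Jacobowitz1962, §7] -/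
theorem eq_of_span_image_eq_span_image (O' : Subring B) (hO' : ∀ r : 𝒪[E], algebraMap E B (r : E) ∈ O') (w w' : Fin n → E) (g : GL (Fin n) E)
    (hg : Submodule.span 𝒪[E] ((fun b : B => φ b *ᵥ w) '' (O : Set B)) = Submodule.span 𝒪[E] (Set.range ((g : Matrix (Fin n) (Fin n) E))ᵀ))
    (h : Submodule.span 𝒪[E] ((fun b : B => φ b *ᵥ w) '' (O : Set B)) = Submodule.span 𝒪[E] ((fun b : B => φ b *ᵥ w') '' (O' : Set B))) :
    O = O' := by
  have h1 := setOf_map_le_span_image_eq_of_eq_span_range τ hK φ hφ τB hτB O hO w g hg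
  have h2 := setOf_map_le_span_image_eq_of_eq_span_range τ hK φ hφ τB hτB O' hO' w' g (by rw [← h, hg])
  rw [← h] at h2
  exact SetLike.coe_injective (h1.symm.trans h2)

end General

/-! ## §1 (B1) Completeness: a self-dual lattice is cyclic over its multiplier ring (endoscopic carrier `B = E × K`, `n = 3`) -/

section Endoscopic

variable {E : Type*} [Field E] [ValuativeRel E] (σ : E →+* E) {K : Type*} [Field K] [Algebra E K] (σK : K →+* K)
  (hσσ : ∀ x, σ (σ x) = x) (hσK : ∀ x, σK (σK x) = x) (hσO : ∀ x : 𝒪[E], σ x ∈ 𝒪[E]) (hK2 : Module.finrank E K = 2)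
  (J : GL (Fin 3) E) (hJ : J ∈ glInt 3 E)
  (τ : Matrix (Fin 3) (Fin 3) E) {w₀ : Fin 3 → E} (hK : IsUnit (Matrix.of fun i j : Fin 3 => ((τ ^ (j : ℕ)) *ᵥ w₀) i).det)
  (φ : (E × K) →ₐ[E] Matrix (Fin 3) (Fin 3) E) (hφ : Function.Injective φ) (τB : E × K) (hτB : φ τB = τ)
  (hstar : ∀ b : E × K, (J : Matrix (Fin 3) (Fin 3) E) * φ (RingHom.prodMap σ σK b) = ((φ b).map σ)ᵀ * J)
  (hordσ : ∀ L : Submodule 𝒪[E] K, L.FG → ∀ c : K, c • L ≤ L → σK c • L ≤ L)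

include hσσ hσK hσO hK2 hJ hK hφ hτB hstar hordσ in
/-- **(B1) COMPLETENESS — every self-dual lattice is cyclic over its multiplier ring.**  For `Λ = Λ(u)`, `u ∈ U(σ, J)`: the multiplier ring
`O(Λ) = {x ∈ E × K : φ(x)·Λ ≤ Λ}` is a subring containing `𝒪`, and `Λ = Λ_{O(Λ)}(w)` for some `w`.  Transport of ★ (O4-G) `exists_generator_of_selfDual_glued` along the orbit
isomorphism `Ψ`: the pulled-back pairing `P(m, m′) = σ(Ψm)ᵀ J Ψm′` has adjoint `b ↦ b⋆` (`hstar`), is orthogonal for `E × 0 ⊥ 0 × K`, self-duality reads `m′ ∈ Λ′ ⟺ P(Λ′, m′) ⊆ 𝒪` (★ (T2)),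
and `pr_K Λ′ = span_𝒪{a, b}` with `a, b` `E`-independent, `(b∕a)² = s(b∕a) − m` (★ (T3)). [cite: Bass1963, §7] [cite: Jacobowitz1962, §4, §7] [cite: Serre1980Trees, Ch. II §1.1] -/
theorem exists_subring_span_image_eq_of_selfDual {Λ : Submodule 𝒪[E] (Fin 3 → E)}
    (hΛ : ∃ u ∈ unitaryGroupOfForm σ (J : Matrix (Fin 3) (Fin 3) E), Λ = Submodule.span 𝒪[E] (Set.range ((u : Matrix (Fin 3) (Fin 3) E))ᵀ)) :
    ∃ O : Subring (E × K), (∀ r : 𝒪[E], algebraMap E (E × K) (r : E) ∈ O) ∧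
      (O : Set (E × K)) = {x : E × K | Λ.map ((Matrix.toLin' (φ x)).restrictScalars 𝒪[E]) ≤ Λ} ∧
      ∃ w : Fin 3 → E, Λ = Submodule.span 𝒪[E] ((fun b : E × K => φ b *ᵥ w) '' (O : Set (E × K))) := by
  obtain ⟨Ψ, hΨ⟩ := exists_linearEquiv_eq_mulVec τ hK φ hφ τB hτB
  obtain ⟨u, hu, rfl⟩ := hΛ
  -- the pulled-back lattice `Λ′ ≤ E × K`
  set Λ' : Submodule 𝒪[E] (E × K) :=
    (Submodule.span 𝒪[E] (Set.range ((u : Matrix (Fin 3) (Fin 3) E))ᵀ)).comap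
      ((Ψ.restrictScalars 𝒪[E] : (E × K) ≃ₗ[𝒪[E]] (Fin 3 → E)) : (E × K) →ₗ[𝒪[E]] (Fin 3 → E)) with hΛ'def
  have hmem : ∀ m, m ∈ Λ' ↔ Ψ m ∈ Submodule.span 𝒪[E] (Set.range ((u : Matrix (Fin 3) (Fin 3) E))ᵀ) := fun m => Iff.rfl
  have hΨmul : ∀ b m : E × K, Ψ (b * m) = φ b *ᵥ Ψ m := fun b m => by rw [hΨ, hΨ, map_mul, Matrix.mulVec_mulVec]
  -- the pairing, its adjoint, orthogonality
  set P : E × K → E × K → E := fun m m' => dotProduct (fun i => σ (Ψ m i)) ((J : Matrix (Fin 3) (Fin 3) E) *ᵥ Ψ m') with hPdef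
  have hss : ∀ b : E × K, RingHom.prodMap σ σK (RingHom.prodMap σ σK b) = b := fun b => Prod.ext (hσσ b.1) (hσK b.2)
  have hadj : ∀ b m m', P (b * m) m' = P m (RingHom.prodMap σ σK b * m') := by
    intro b m m'
    simp only [hPdef]
    rw [hΨmul b m, hΨmul (RingHom.prodMap σ σK b) m', dotProduct_map_mulVec_eq, Matrix.mulVec_mulVec, Matrix.mulVec_mulVec, ← hstar b]
  have hadj' : ∀ b m m', P m (b * m') = P (RingHom.prodMap σ σK b * m) m' := by
    intro b m m'
    rw [hadj, hss]
  have hPadd : ∀ m₁ m₂ m', P (m₁ + m₂) m' = P m₁ m' + P m₂ m' := by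
    intro m₁ m₂ m'
    simp only [hPdef]
    have h : (fun i => σ (Ψ (m₁ + m₂) i)) = (fun i => σ (Ψ m₁ i)) + fun i => σ (Ψ m₂ i) := by
      funext i; simp only [map_add, Pi.add_apply]
    rw [h, add_dotProduct]
  have hP0 : ∀ m, P m 0 = 0 := fun m => by simp only [hPdef, map_zero, Matrix.mulVec_zero, dotProduct_zero]
  have horth : ∀ (x : E) (x' : K), P ((x, 0) : E × K) ((0, x') : E × K) = 0 := by
    intro x x'
    have h1 : ((x, 0) : E × K) = ((1, 0) : E × K) * ((x, 0) : E × K) := by ext <;> simp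
    have h2 : RingHom.prodMap σ σK ((1, 0) : E × K) * ((0, x') : E × K) = 0 := by ext <;> simp
    rw [h1, hadj, h2, hP0]
  have hPT : ∀ (m' : E × K) (x' : K), P m' ((0, x') : E × K) = P ((0, m'.2) : E × K) ((0, x') : E × K) := by
    intro m' x'
    have hsplit : m' = ((m'.1, 0) : E × K) + ((0, m'.2) : E × K) := by ext <;> simp
    conv_lhs => rw [hsplit]
    rw [hPadd, horth, zero_add]
  have hT : ∀ c x x' : K, P ((0, x) : E × K) ((0, c * x') : E × K) = P ((0, σK c * x) : E × K) ((0, x') : E × K) := by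
    intro c x x'
    have h1 : ((0, c * x') : E × K) = ((0, c) : E × K) * ((0, x') : E × K) := by ext <;> simp
    have h2 : RingHom.prodMap σ σK ((0, c) : E × K) * ((0, x) : E × K) = ((0, σK c * x) : E × K) := by ext <;> simp
    rw [h1, hadj', h2]
  -- self-duality in membership form, pulled back (★ (T2))
  have hsd : ∀ m', m' ∈ Λ' ↔ ∀ m'' ∈ Λ', P m'' m' ∈ 𝒪[E] := by
    intro m'
    rw [hmem, mem_span_range_transpose_iff_forall_dotProduct_mem σ hσO J hJ hu]
    constructor
    · intro h m'' hm''
      exact h (Ψ m'') ((hmem m'').1 hm'')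
    · intro h y hy
      have hy' : Ψ.symm y ∈ Λ' := by rw [hmem, LinearEquiv.apply_symm_apply]; exact hy
      have h1 := h _ hy'
      simp only [hPdef, LinearEquiv.apply_symm_apply] at h1
      exact h1
  -- finite generation
  have hΛ'map : Λ' = (Submodule.span 𝒪[E] (Set.range ((u : Matrix (Fin 3) (Fin 3) E))ᵀ)).map
      ((Ψ.restrictScalars 𝒪[E]).symm : (Fin 3 → E) →ₗ[𝒪[E]] (E × K)) := by
    rw [hΛ'def]; exact Submodule.comap_equiv_eq_map_symm _ _
  have hfg' : Λ'.FG := by rw [hΛ'map]; exact (Submodule.fg_span (Set.finite_range _)).map _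
  -- `pr_K Λ′` is spanned by the `K`-parts of the three columns, which span `K` over `E`
  set z : Fin 3 → E × K := fun j => (Ψ.restrictScalars 𝒪[E]).symm (((u : Matrix (Fin 3) (Fin 3) E))ᵀ j) with hzdef
  have hΛ'span : Λ' = Submodule.span 𝒪[E] (Set.range z) := by
    rw [hΛ'map, Submodule.map_span, ← Set.range_comp]; rfl
  set x : Fin 3 → K := fun j => (z j).2 with hxdef
  have hL : Λ'.map ((LinearMap.snd E E K).restrictScalars 𝒪[E]) = Submodule.span 𝒪[E] (Set.range x) := by
    rw [hΛ'span, Submodule.map_span, ← Set.range_comp]; rfl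
  have hxtop : Submodule.span E (Set.range x) = ⊤ := by
    have h1 : Submodule.span E (Set.range z) = ⊤ := by
      have h : Submodule.span E (Set.range z) =
          (Submodule.span E (Set.range ((u : Matrix (Fin 3) (Fin 3) E))ᵀ)).map (Ψ.symm : (Fin 3 → E) →ₗ[E] (E × K)) := by
        rw [Submodule.map_span, ← Set.range_comp]; rfl
      rw [h, span_range_transpose_eq_top, Submodule.map_top, LinearMap.range_eq_top]
      exact Ψ.symm.surjective
    have h2 : Submodule.span E (Set.range x) = (Submodule.span E (Set.range z)).map (LinearMap.snd E E K) := by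
      rw [Submodule.map_span, ← Set.range_comp]; rfl
    rw [h2, h1, Submodule.map_top, LinearMap.range_eq_top]
    exact Prod.snd_surjective
  obtain ⟨a, b, hab, hspan⟩ := exists_span_range_eq_span_pair hK2 x hxtop
  obtain ⟨s, m, hsm⟩ := exists_sq_eq_of_linearIndependent hK2 a b hab
  have hL2 : Λ'.map ((LinearMap.snd E E K).restrictScalars 𝒪[E]) = Submodule.span 𝒪[E] ({a, b} : Set K) := hL.trans hspan
  have hdag : ∀ c : K, c • Λ'.map ((LinearMap.snd E E K).restrictScalars 𝒪[E]) ≤ Λ'.map ((LinearMap.snd E E K).restrictScalars 𝒪[E]) →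
      σK c • Λ'.map ((LinearMap.snd E E K).restrictScalars 𝒪[E]) ≤ Λ'.map ((LinearMap.snd E E K).restrictScalars 𝒪[E]) :=
    fun c hc => hordσ _ (hfg'.map _) c hc
  -- ★ (O4-G): `Λ′` is cyclic over its multiplier ring
  obtain ⟨v, hv, hgen⟩ := exists_generator_of_selfDual_glued Λ' (hfg'.map _) a b (hab.ne_zero 0) s m hsm hab hL2 P
    (fun y y' => P ((0, y) : E × K) ((0, y') : E × K)) σK hPT hT hsd hdag
  -- the multiplier ring, as a subring
  let O : Subring (E × K) :=
    { carrier := {c | ∀ m' ∈ Λ', c * m' ∈ Λ'}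
      mul_mem' := fun {c c'} hc hc' m' hm' => by rw [mul_assoc]; exact hc _ (hc' m' hm')
      one_mem' := fun m' hm' => by rwa [one_mul]
      add_mem' := fun {c c'} hc hc' m' hm' => by rw [add_mul]; exact Λ'.add_mem (hc m' hm') (hc' m' hm')
      zero_mem' := fun m' _ => by rw [zero_mul]; exact Λ'.zero_mem
      neg_mem' := fun {c} hc m' hm' => by rw [neg_mul]; exact Λ'.neg_mem (hc m' hm') }
  have hOmem : ∀ c, c ∈ O ↔ ∀ m' ∈ Λ', c * m' ∈ Λ' := fun c => Iff.rfl
  have hsmulO : ∀ c : E × K, c • Λ' ≤ Λ' ↔ c ∈ O := fun c => by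
    rw [hOmem, pointwise_smul_le_iff_forall]; rfl
  refine ⟨O, fun r m' hm' => ?_, ?_, Ψ v, ?_⟩
  · -- `𝒪 ⊆ O(Λ)`
    rw [← Algebra.smul_def]
    exact Λ'.smul_mem r hm'
  · -- `O = {x : φ(x)·Λ ≤ Λ}`
    ext c
    rw [SetLike.mem_coe, hOmem, Set.mem_setOf_eq]
    constructor
    · intro hc
      rw [Submodule.map_le_iff_le_comap]
      intro y hy
      have hm : Ψ.symm y ∈ Λ' := by rw [hmem, LinearEquiv.apply_symm_apply]; exact hy
      have h1 := (hmem _).1 (hc _ hm)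
      rw [hΨmul, LinearEquiv.apply_symm_apply] at h1
      exact h1
    · intro hc m' hm'
      rw [hmem, hΨmul]
      exact hc (Submodule.mem_map.2 ⟨Ψ m', (hmem m').1 hm', rfl⟩)
  · -- `Λ = Λ_{O(Λ)}(Ψ v)`
    apply le_antisymm
    · intro y hy
      have hm : Ψ.symm y ∈ Λ' := by rw [hmem, LinearEquiv.apply_symm_apply]; exact hy
      obtain ⟨c, hcΛ, hcv⟩ := hgen _ hm
      refine Submodule.subset_span ⟨c, (hsmulO c).1 hcΛ, ?_⟩
      show φ c *ᵥ Ψ v = y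
      rw [← hΨmul, ← hcv, LinearEquiv.apply_symm_apply]
    · rw [Submodule.span_le]
      rintro _ ⟨c, hc, rfl⟩
      show φ c *ᵥ Ψ v ∈ _
      rw [← hΨmul]
      exact (hmem _).1 ((hOmem c).1 hc v hv)

/-! ## §2 (B2) The partition of the self-dual `τ`-stable lattices by multiplier over-orders -/

include hσσ hσK hσO hK2 hJ hK hφ hτB hstar hordσ in
/-- **(B2) THE PARTITION.**  The self-dual `τ`-stable lattices are the union, over any family `𝓞` of over-orders `∋ τ_B` (containing the scalars) that contains every multiplier ring
`O(Λ)`, of the strata `S_O = {Λ | self-dual ∧ ∃ w, Λ = Λ_O(w)}` (complete by (B1); `τ`-stable `⟺ τ_B ∈ O(Λ)`). [cite: Jacobowitz1962, §7] [cite: Serre1980Trees, Ch. II §1.1] -/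
theorem setOf_selfDual_stable_eq_biUnion (𝓞 : Set (Subring (E × K)))
    (h𝓞 : ∀ O ∈ 𝓞, (∀ r : 𝒪[E], algebraMap E (E × K) (r : E) ∈ O) ∧ τB ∈ O)
    (hcov : ∀ Λ : Submodule 𝒪[E] (Fin 3 → E),
      (∃ u ∈ unitaryGroupOfForm σ (J : Matrix (Fin 3) (Fin 3) E), Λ = Submodule.span 𝒪[E] (Set.range ((u : Matrix (Fin 3) (Fin 3) E))ᵀ)) →
        Λ.map ((Matrix.toLin' τ).restrictScalars 𝒪[E]) ≤ Λ → ∃ O ∈ 𝓞, (O : Set (E × K)) = {x : E × K | Λ.map ((Matrix.toLin' (φ x)).restrictScalars 𝒪[E]) ≤ Λ}) :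
    {Λ : Submodule 𝒪[E] (Fin 3 → E) |
        (∃ u ∈ unitaryGroupOfForm σ (J : Matrix (Fin 3) (Fin 3) E), Λ = Submodule.span 𝒪[E] (Set.range ((u : Matrix (Fin 3) (Fin 3) E))ᵀ)) ∧
          Λ.map ((Matrix.toLin' τ).restrictScalars 𝒪[E]) ≤ Λ} =
      ⋃ O ∈ 𝓞, {Λ : Submodule 𝒪[E] (Fin 3 → E) |
        (∃ u ∈ unitaryGroupOfForm σ (J : Matrix (Fin 3) (Fin 3) E), Λ = Submodule.span 𝒪[E] (Set.range ((u : Matrix (Fin 3) (Fin 3) E))ᵀ)) ∧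
          ∃ w : Fin 3 → E, Λ = Submodule.span 𝒪[E] ((fun b : E × K => φ b *ᵥ w) '' (O : Set (E × K)))} := by
  ext Λ
  simp only [Set.mem_setOf_eq, Set.mem_iUnion, exists_prop]
  constructor
  · rintro ⟨hsd, hst⟩
    obtain ⟨O', hO', hcoe, w, hw⟩ := exists_subring_span_image_eq_of_selfDual σ σK hσσ hσK hσO hK2 J hJ τ hK φ hφ τB hτB hstar hordσ hsd
    obtain ⟨O, hO𝓞, hOcoe⟩ := hcov Λ hsd hst
    have hOO' : O = O' := SetLike.coe_injective (hOcoe.trans hcoe.symm)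
    exact ⟨O, hO𝓞, hsd, w, hOO' ▸ hw⟩
  · rintro ⟨O, hO𝓞, hsd, w, rfl⟩
    refine ⟨hsd, ?_⟩
    rw [← hτB]
    exact map_span_image_le_of_mem φ O (h𝓞 O hO𝓞).1 τB (h𝓞 O hO𝓞).2 w

include hσσ hσK hσO hK2 hJ hK hφ hτB hstar hordσ in
/-- **(B2) THE COUNT AS A SUM OVER OVER-ORDERS**: `#{self-dual τ-stable Λ} = Σ_{O ∈ 𝓞} #S_O` for any finite family `𝓞` as in `setOf_selfDual_stable_eq_biUnion` — the strata are pairwise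
disjoint by the multiplier reading (A8).  (Each `#S_O = [C_O : O^×]` by ★ F3-2a `ncard_setOf_selfDual_cyclicOver_eq_relIndex`.) [cite: Jacobowitz1962, §7] [cite: Rogawski1990, §4.9 Lemma 4.9.3 p. 56] -/
theorem ncard_setOf_selfDual_stable_eq_finsum (𝓞 : Set (Subring (E × K))) (h𝓞fin : 𝓞.Finite)
    (h𝓞 : ∀ O ∈ 𝓞, (∀ r : 𝒪[E], algebraMap E (E × K) (r : E) ∈ O) ∧ τB ∈ O)
    (hcov : ∀ Λ : Submodule 𝒪[E] (Fin 3 → E),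
      (∃ u ∈ unitaryGroupOfForm σ (J : Matrix (Fin 3) (Fin 3) E), Λ = Submodule.span 𝒪[E] (Set.range ((u : Matrix (Fin 3) (Fin 3) E))ᵀ)) →
        Λ.map ((Matrix.toLin' τ).restrictScalars 𝒪[E]) ≤ Λ → ∃ O ∈ 𝓞, (O : Set (E × K)) = {x : E × K | Λ.map ((Matrix.toLin' (φ x)).restrictScalars 𝒪[E]) ≤ Λ})
    (hfin : {Λ : Submodule 𝒪[E] (Fin 3 → E) |
        (∃ u ∈ unitaryGroupOfForm σ (J : Matrix (Fin 3) (Fin 3) E), Λ = Submodule.span 𝒪[E] (Set.range ((u : Matrix (Fin 3) (Fin 3) E))ᵀ)) ∧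
          Λ.map ((Matrix.toLin' τ).restrictScalars 𝒪[E]) ≤ Λ}.Finite) :
    {Λ : Submodule 𝒪[E] (Fin 3 → E) |
        (∃ u ∈ unitaryGroupOfForm σ (J : Matrix (Fin 3) (Fin 3) E), Λ = Submodule.span 𝒪[E] (Set.range ((u : Matrix (Fin 3) (Fin 3) E))ᵀ)) ∧
          Λ.map ((Matrix.toLin' τ).restrictScalars 𝒪[E]) ≤ Λ}.ncard =
      ∑ᶠ O ∈ 𝓞, {Λ : Submodule 𝒪[E] (Fin 3 → E) |
        (∃ u ∈ unitaryGroupOfForm σ (J : Matrix (Fin 3) (Fin 3) E), Λ = Submodule.span 𝒪[E] (Set.range ((u : Matrix (Fin 3) (Fin 3) E))ᵀ)) ∧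
          ∃ w : Fin 3 → E, Λ = Submodule.span 𝒪[E] ((fun b : E × K => φ b *ᵥ w) '' (O : Set (E × K)))}.ncard := by
  have hU := setOf_selfDual_stable_eq_biUnion σ σK hσσ hσK hσO hK2 J hJ τ hK φ hφ τB hτB hstar hordσ 𝓞 h𝓞 hcov
  rw [hU] at hfin ⊢
  refine h𝓞fin.ncard_biUnion (fun O hO => hfin.subset fun Λ hΛ => Set.mem_biUnion hO hΛ) ?_
  intro O hO O' hO' hne
  refine Set.disjoint_left.2 fun Λ hΛ hΛ' => hne ?_
  obtain ⟨⟨g, -, hg⟩, w, rfl⟩ := hΛ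
  obtain ⟨-, w', hw'⟩ := hΛ'
  exact eq_of_span_image_eq_span_image τ hK φ hφ τB hτB O (h𝓞 O hO).1 O' (h𝓞 O' hO').1 w w' g hg hw'

end Endoscopic

end Literature.NumberTheory.Automorphic

end
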